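import Summits.ValiantsHypothesis.ValiantsHypothesis.Theorems.LacunarySymmetroidMatrixDescartesPivotRankOneFourKillSeven
import Summits.ValiantsHypothesis.ValiantsHypothesis.Theorems.LacunarySymmetroidMatrixDescartesCensusLaguerreSum
import Summits.ValiantsHypothesis.ValiantsHypothesis.Theorems.LacunarySymmetroidMatrixDescartesCensusPivotTwoDescartes
import Summits.ValiantsHypothesis.ValiantsHypothesis.Theorems.LacunarySymmetroidMatrixDescartesCensusFullAlternation

/-!
# `MatrixDescartes` census — the `(2,4)₁` cell with RANK-ONE letters: `Z₊ ≤ 8 = 2K` OUTSIDE the two interleaving chambers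
# (a block-chopping Descartes argument; the rank-one law is thereby OPEN ONLY in chamber (B) and its mirror (A))

HONEST FRAMING.  Object-search cell `pub-symmetroid`, seat `val-sym-mdr-p1` (generation 13); helper file `--supports` the crux item
stmt-ValiantsHypothesis-18050 (`Theses.LacunarySymmetroid.MatrixDescartes`, OPEN, on HOLD) with NO closure claim.  Companion of the
seat's kill-seven files `…PivotRankOneFourKillSeven{,Prime,Pairs,Bottom}` (generation 12: `Z₊ ≤ 8` INSIDE chamber (B) under explicit
angular conditions) and of `…PivotRankOneEight` (this generation: `8` is attained with rank-one all-core letters).  This file does the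
complementary, elementary part: EVERYWHERE ELSE the bound `8` is Descartes bookkeeping, made kernel once and for all.

SETTING.  `F = X^e J + ∑ₖ wₖ X^{dₖ} vₖvₖᵀ`, `k = 0..3`, two letters below and two above the pivot (`d₀ < d₁ < e < d₂ < d₃`), `J` ANY real
`2 × 2` matrix, `wₖ ≥ 0`, directions arbitrary.  `det F` is the eleven-nomial of `det_rankOne_four_sum` on the degrees
`c = 2e`, `sₖ = e + dₖ` (the five PIVOT-TYPE degrees, coefficients `det J`, `wₖ·m(J,vₖ)` of either sign) and `pₖₗ = dₖ + dₗ` (the six PAIR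
degrees, coefficients `wₖwₗΔₖₗ² ≥ 0`).  A negative coefficient can only sit at a pivot-type degree (`eq_pivotDegree_of_coeff_neg`), so
Descartes gives `10` at most, and `10` needs the five pivot-type degrees `s₀ < s₁ < c < s₂ < s₃` to be separated by pair degrees.  Only
`p₀₂, p₀₃` can separate `s₀, s₁`, only `p₀₃, p₁₃` can separate `s₂, s₃`, and counting shows that perfect interleaving happens in exactly TWO
orders of the eleven degrees — chamber (B) `p₀₁ s₀ p₀₂ s₁ p₁₂ c p₀₃ s₂ p₁₃ s₃ p₂₃` (`d₁+d₂ < 2e`, `d₀+d₂ < e+d₁`, `2e < d₀+d₃ < e+d₂`;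
the home of the tree's interleaved EIGHT and of the kill-seven theorems) and its mirror (A) `p₀₁ s₀ p₀₂ s₁ p₀₃ c p₁₂ s₂ p₁₃ s₃ p₂₃`
(`e+d₁ < d₀+d₃ < 2e < d₁+d₂`, `e+d₂ < d₁+d₃`); in every other configuration (including all coincidences of degrees and all vanishing
pair coefficients) one of the four gaps `(s₀,s₁)`, `(s₁,c)`, `(c,s₂)`, `(s₂,s₃)` carries no pair degree (`gap_of_not_interleaving`, linear
arithmetic).

**THEOREM (`rankOne_posRoots_le_eight_of_not_interleaving`; real-parameter form `elevenNomial_le_eight_of_not_interleaving`).**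
Outside the open chambers (A) and (B): `Z₊ ≤ 8`.  PROOF (no case analysis on the order beyond the empty gap): if one of the five
pivot-type coefficients of `det F` (as a polynomial coefficient, i.e. merged with a coinciding pair term if any) is `≥ 0`, at most four
coefficients are negative and the tree's `TwoDescartes.card_posRoots_le_two_mul_card` gives `8` (`elevenNomial_le_eight_of_coeff_nonneg`);
otherwise all five are negative and the empty gap `[N, N']` between two consecutive pivot-type degrees is a window of non-positive
coefficients with exactly three negative degrees outside it, and the generic **window lemma** `signVariations_le_of_nonpos_window`
(`Var(f) ≤ 2·#T + 2` whenever the coefficients on `[a,b]` are `≤ 0` and the negative ones outside lie in `T` — chop `f = L + X^a(M + X^{b+1−a}U)`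
with the tree's splitting inequality `Census.signVariations_add_X_pow_mul_le`, `Var(M) = 0`, `Var(L), Var(U) ≤ 2·#neg`) gives `Var ≤ 8`.
NOT CLAIMED: anything inside chambers (A)/(B) (Descartes `10`; located by this seat: no rank-one design beyond `8` anywhere, none beyond
`4` found inside (B) by random search — located only).  Nothing here bears on `MatrixDescartes` in its window, on `DoorA26` / `DoorA34`,
registers / credences, or `VP ≠ VNP`.

[folklore] Descartes' rule of signs with sign-pattern bookkeeping; tree lemmas named above (`Census.signVariations_add_X_pow_mul_le`,
`Census.coeff_sum_C_mul_X_pow`, `Census.card_posRoots_le_signVariations`, `TwoDescartes.signVariations_add_le_two_mul_card_negSupp`,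
`TwoDescartes.card_posRoots_le_two_mul_card`, `TwoDirections.BlockLaw.det_rankOne_four_sum`,
`Literature…Descartes.signVariations_eq_zero_of_coeff_nonpos`).  No definitions, no named facts.
-/

-- `Summit.ValiantsHypothesis.ValiantsHypothesis.…` repeats a component by the D-0017 layout
-- (single-conjunct summit), which the `dupNamespace` linter flags; the name is mandated.
set_option linter.dupNamespace false

namespace Summit.ValiantsHypothesis.ValiantsHypothesis.Theorems.LacunarySymmetroidMatrixDescartes.Pivot.RankOneReduction

open Polynomial Matrix Finset
open scoped BigOperators

/-! ## 1. A generic window lemma for sign variations -/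

/-- **Non-positive window lemma.**  If all coefficients of `f` in the degree window `[a, b]` are `≤ 0` and every negative
coefficient outside the window sits at a degree in `T`, then `Var(f) ≤ 2·#T + 2`: chop the coefficient sequence into the block
below `a`, the window, and the block above `b`; the window has `Var = 0`, each outer block has `Var ≤ 2·#(its negative degrees)`,
and the two junctions cost at most one each. [folklore] -/
theorem signVariations_le_of_nonpos_window (f : ℝ[X]) (a b : ℕ) (hab : a ≤ b)
    (hwin : ∀ m, a ≤ m → m ≤ b → f.coeff m ≤ 0) (T : Finset ℕ)
    (hT : ∀ m, f.coeff m < 0 → (m < a ∨ b < m) → m ∈ T) :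
    f.signVariations ≤ 2 * T.card + 2 := by
  classical
  -- the three blocks
  set N := f.natDegree + 1 with hN
  set L : ℝ[X] := ∑ m ∈ range a, C (f.coeff m) * X ^ m with hL
  set M : ℝ[X] := ∑ m ∈ range (b + 1 - a), C (f.coeff (a + m)) * X ^ m with hM
  set U : ℝ[X] := ∑ m ∈ range N, C (f.coeff (b + 1 + m)) * X ^ m with hU
  have hLc : ∀ i, L.coeff i = if i < a then f.coeff i else 0 := fun i => by
    rw [hL, Census.coeff_sum_C_mul_X_pow]
  have hMc : ∀ i, M.coeff i = if i < b + 1 - a then f.coeff (a + i) else 0 := fun i => by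
    rw [hM, Census.coeff_sum_C_mul_X_pow]
  have hUc : ∀ i, U.coeff i = if i < N then f.coeff (b + 1 + i) else 0 := fun i => by
    rw [hU, Census.coeff_sum_C_mul_X_pow]
  have hUc' : ∀ i, U.coeff i = f.coeff (b + 1 + i) := fun i => by
    rw [hUc]
    split_ifs with h
    · rfl
    · rw [coeff_eq_zero_of_natDegree_lt (by omega)]
  -- the decomposition
  have hf : f = L + X ^ a * (M + X ^ (b + 1 - a) * U) := by
    ext i
    rw [coeff_add, coeff_X_pow_mul', coeff_add, coeff_X_pow_mul', hLc, hMc, hUc']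
    by_cases h1 : i < a
    · rw [if_pos h1, if_neg (by omega), add_zero]
    rw [if_neg h1, zero_add, if_pos (by omega)]
    by_cases h2 : i - a < b + 1 - a
    · rw [if_pos h2, if_neg (by omega), add_zero]
      congr 1; omega
    · rw [if_neg h2, zero_add, if_pos (by omega)]
      congr 1; omega
  -- Var of the window block vanishes
  have hVM : M.signVariations = 0 := by
    refine Literature.Algebra.Polynomial.Descartes.signVariations_eq_zero_of_coeff_nonpos fun n => ?_
    rw [hMc]
    split_ifs with h
    · exact hwin _ (by omega) (by omega)
    · exact le_rfl
  -- degrees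
  have hdegM : M.natDegree < b + 1 - a := by
    have h1 : M.natDegree ≤ b - a := by
      rw [hM]
      refine natDegree_sum_le_of_forall_le _ _ fun i hi => ?_
      have := Finset.mem_range.mp hi
      exact (natDegree_C_mul_X_pow_le _ _).trans (by omega)
    omega
  -- negative supports of the outer blocks inject into `T`
  have hnegL : ∀ n ∈ TwoDescartes.negSupp L, n ∈ T ∧ n < a := by
    intro n hn
    simp only [TwoDescartes.negSupp, Finset.mem_filter] at hn
    have h := hn.2
    rw [hLc] at h
    split_ifs at h with h1
    · exact ⟨hT n h (Or.inl h1), h1⟩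
    · exact absurd h (lt_irrefl 0)
  have hnegU : ∀ n ∈ TwoDescartes.negSupp U, b + 1 + n ∈ T := by
    intro n hn
    simp only [TwoDescartes.negSupp, Finset.mem_filter] at hn
    have h := hn.2
    rw [hUc'] at h
    exact hT _ h (Or.inr (by omega))
  have hcard : (TwoDescartes.negSupp L).card + (TwoDescartes.negSupp U).card ≤ T.card := by
    have hinj : Function.Injective (fun n : ℕ => b + 1 + n) := fun x y hxy => by simpa using hxy
    rw [← Finset.card_image_of_injective (TwoDescartes.negSupp U) hinj]
    rw [← Finset.card_union_of_disjoint]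
    · refine Finset.card_le_card fun n hn => ?_
      rcases Finset.mem_union.mp hn with h | h
      · exact (hnegL n h).1
      · obtain ⟨k, hk, rfl⟩ := Finset.mem_image.mp h
        exact hnegU k hk
    · refine Finset.disjoint_left.mpr fun n hnL hnU => ?_
      obtain ⟨k, _, rfl⟩ := Finset.mem_image.mp hnU
      have := (hnegL _ hnL).2
      omega
  have hVL : L.signVariations ≤ 2 * (TwoDescartes.negSupp L).card :=
    le_trans (Nat.le_add_right _ _) (TwoDescartes.signVariations_add_le_two_mul_card_negSupp L)
  have hVU : U.signVariations ≤ 2 * (TwoDescartes.negSupp U).card :=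
    le_trans (Nat.le_add_right _ _) (TwoDescartes.signVariations_add_le_two_mul_card_negSupp U)
  -- inner junction
  have hinner : (M + X ^ (b + 1 - a) * U).signVariations ≤ U.signVariations + 1 := by
    have := Census.signVariations_add_X_pow_mul_le M U hdegM
    omega
  -- outer junction
  by_cases ha : a = 0
  · have hL0 : L = 0 := by rw [hL, ha, Finset.range_zero, Finset.sum_empty]
    have hXa : (X : ℝ[X]) ^ a = 1 := by rw [ha, pow_zero]
    rw [hf, hL0, zero_add, hXa, one_mul]
    omega
  · have hdegL : L.natDegree < a := by
      have h1 : L.natDegree ≤ a - 1 := by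
        rw [hL]
        refine natDegree_sum_le_of_forall_le _ _ fun i hi => ?_
        have := Finset.mem_range.mp hi
        exact (natDegree_C_mul_X_pow_le _ _).trans (by omega)
      omega
    have houter := Census.signVariations_add_X_pow_mul_le L (M + X ^ (b + 1 - a) * U) hdegL
    rw [hf]
    omega

/-! ## 2. The rank-one `(2,4)₁` eleven-nomial: negative coefficients only at the five pivot-type degrees -/

/-- Coefficients of the eleven-nomial `∑ᵢ C(cᵢ) X^{nᵢ}` on the degrees `(2e, e+d₀, e+d₁, e+d₂, e+d₃, d₀+d₁, d₀+d₂, d₀+d₃, d₁+d₂, d₁+d₃, d₂+d₃)`. -/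
theorem coeff_elevenNomial (e d₀ d₁ d₂ d₃ : ℕ) (cv : Fin 11 → ℝ) (m : ℕ) :
    (∑ i : Fin 11, Polynomial.C (cv i) * X ^ ((![2 * e, e + d₀, e + d₁, e + d₂, e + d₃, d₀ + d₁, d₀ + d₂, d₀ + d₃, d₁ + d₂, d₁ + d₃, d₂ + d₃] : Fin 11 → ℕ) i)).coeff m
      = ∑ i : Fin 11, (if m = (![2 * e, e + d₀, e + d₁, e + d₂, e + d₃, d₀ + d₁, d₀ + d₂, d₀ + d₃, d₁ + d₂, d₁ + d₃, d₂ + d₃] : Fin 11 → ℕ) i then cv i else 0) := by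
  rw [finsetSum_coeff]
  simp only [coeff_C_mul_X_pow]

/-- If the six PAIR coefficients (positions `5, …, 10`) are non-negative, a negative coefficient can only sit at one of the five
pivot-type degrees `2e, e+d₀, e+d₁, e+d₂, e+d₃`. -/
theorem eq_pivotDegree_of_coeff_neg (e d₀ d₁ d₂ d₃ : ℕ) (cv : Fin 11 → ℝ) (hpos : ∀ i : Fin 11, 5 ≤ (i : ℕ) → 0 ≤ cv i)
    (m : ℕ)
    (hm : (∑ i : Fin 11, Polynomial.C (cv i) * X ^ ((![2 * e, e + d₀, e + d₁, e + d₂, e + d₃, d₀ + d₁, d₀ + d₂, d₀ + d₃, d₁ + d₂, d₁ + d₃, d₂ + d₃] : Fin 11 → ℕ) i)).coeff m < 0) :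
    m = 2 * e ∨ m = e + d₀ ∨ m = e + d₁ ∨ m = e + d₂ ∨ m = e + d₃ := by
  rw [coeff_elevenNomial] at hm
  by_contra hcon
  push Not at hcon
  obtain ⟨h1, h2, h3, h4, h5⟩ := hcon
  refine absurd hm (not_lt.mpr (Finset.sum_nonneg fun i _ => ?_))
  fin_cases i <;> (split_ifs with h) <;> first
      | exact le_rfl
      | exact absurd h h1 | exact absurd h h2 | exact absurd h h3 | exact absurd h h4 | exact absurd h h5
      | exact hpos _ (by simp)

/-- **Off-core / non-negative pivot-type coefficient ⇒ `Z₊ ≤ 8`.**  If the six pair coefficients are non-negative and one of the five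
pivot-type coefficients (merged, i.e. as a coefficient of the polynomial) is non-negative, there are at most four negative coefficients
and Descartes (`TwoDescartes.card_posRoots_le_two_mul_card`) gives at most `8` positive roots. -/
theorem elevenNomial_le_eight_of_coeff_nonneg (e d₀ d₁ d₂ d₃ : ℕ) (cv : Fin 11 → ℝ) (hpos : ∀ i : Fin 11, 5 ≤ (i : ℕ) → 0 ≤ cv i)
    (m₀ : ℕ) (hm₀ : m₀ = 2 * e ∨ m₀ = e + d₀ ∨ m₀ = e + d₁ ∨ m₀ = e + d₂ ∨ m₀ = e + d₃)
    (h0 : 0 ≤ (∑ i : Fin 11, Polynomial.C (cv i) * X ^ ((![2 * e, e + d₀, e + d₁, e + d₂, e + d₃, d₀ + d₁, d₀ + d₂, d₀ + d₃, d₁ + d₂, d₁ + d₃, d₂ + d₃] : Fin 11 → ℕ) i)).coeff m₀) :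
    ((∑ i : Fin 11, Polynomial.C (cv i) * X ^ ((![2 * e, e + d₀, e + d₁, e + d₂, e + d₃, d₀ + d₁, d₀ + d₂, d₀ + d₃, d₁ + d₂, d₁ + d₃, d₂ + d₃] : Fin 11 → ℕ) i)).roots.toFinset.filter (fun t => 0 < t)).card ≤ 8 := by
  classical
  set f := (∑ i : Fin 11, Polynomial.C (cv i) * X ^ ((![2 * e, e + d₀, e + d₁, e + d₂, e + d₃, d₀ + d₁, d₀ + d₂, d₀ + d₃, d₁ + d₂, d₁ + d₃, d₂ + d₃] : Fin 11 → ℕ) i)) with hf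
  set S : Finset ℕ := {2 * e, e + d₀, e + d₁, e + d₂, e + d₃} with hS
  have hm₀S : m₀ ∈ S := by
    simp only [hS, Finset.mem_insert, Finset.mem_singleton]; omega
  have hT := TwoDescartes.card_posRoots_le_two_mul_card f (S.erase m₀) (fun n hn => by
    have h1 := eq_pivotDegree_of_coeff_neg e d₀ d₁ d₂ d₃ cv hpos n hn
    refine Finset.mem_erase.mpr ⟨fun h => ?_, ?_⟩
    · rw [h] at hn; exact absurd hn (not_lt.mpr h0)
    · simp only [hS, Finset.mem_insert, Finset.mem_singleton]; omega)
  have hcard : (S.erase m₀).card ≤ 4 := by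
    rw [Finset.card_erase_of_mem hm₀S]
    have : S.card ≤ 5 := Finset.card_le_five
    omega
  omega

/-- **THE NON-INTERLEAVING BOUND (real-parameter form).**  For the eleven-nomial on the degrees of a `(2,4)₁` rank-one pencil
(`d₀ < d₁ < e < d₂ < d₃`, non-negative pair coefficients, the five pivot-type coefficients ARBITRARY) suppose one of the four gaps between
consecutive pivot-type degrees `e+d₀ < e+d₁ < 2e < e+d₂ < e+d₃` contains no pair degree (`G1`–`G4` below, linear conditions on the
exponents).  Then `Z₊ ≤ 8`: either some pivot-type coefficient is `≥ 0` (previous theorem), or all five are negative and the empty gap is a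
non-positive window with three negative degrees outside it (`signVariations_le_of_nonpos_window`: `Var ≤ 2·3 + 2`). -/
theorem elevenNomial_le_eight_of_gap (e d₀ d₁ d₂ d₃ : ℕ) (h01 : d₀ < d₁) (h1e : d₁ < e) (he2 : e < d₂) (h23 : d₂ < d₃)
    (hgap : (e + d₁ ≤ d₀ + d₂)
      ∨ (2 * e ≤ d₁ + d₂ ∧ (d₀ + d₂ ≤ e + d₁ ∨ 2 * e ≤ d₀ + d₂) ∧ (d₀ + d₃ ≤ e + d₁ ∨ 2 * e ≤ d₀ + d₃))
      ∨ (d₁ + d₂ ≤ 2 * e ∧ (d₁ + d₃ ≤ 2 * e ∨ e + d₂ ≤ d₁ + d₃) ∧ (d₀ + d₃ ≤ 2 * e ∨ e + d₂ ≤ d₀ + d₃))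
      ∨ (d₁ + d₃ ≤ e + d₂))
    (cv : Fin 11 → ℝ) (hpos : ∀ i : Fin 11, 5 ≤ (i : ℕ) → 0 ≤ cv i) :
    ((∑ i : Fin 11, Polynomial.C (cv i) * X ^ ((![2 * e, e + d₀, e + d₁, e + d₂, e + d₃, d₀ + d₁, d₀ + d₂, d₀ + d₃, d₁ + d₂, d₁ + d₃, d₂ + d₃] : Fin 11 → ℕ) i)).roots.toFinset.filter (fun t => 0 < t)).card ≤ 8 := by
  classical
  set f := (∑ i : Fin 11, Polynomial.C (cv i) * X ^ ((![2 * e, e + d₀, e + d₁, e + d₂, e + d₃, d₀ + d₁, d₀ + d₂, d₀ + d₃, d₁ + d₂, d₁ + d₃, d₂ + d₃] : Fin 11 → ℕ) i)) with hf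
  -- Step 1: some pivot-type coefficient non-negative
  by_cases hc : 0 ≤ f.coeff (2 * e)
  · exact elevenNomial_le_eight_of_coeff_nonneg e d₀ d₁ d₂ d₃ cv hpos (2 * e) (by omega) hc
  by_cases h0 : 0 ≤ f.coeff (e + d₀)
  · exact elevenNomial_le_eight_of_coeff_nonneg e d₀ d₁ d₂ d₃ cv hpos (e + d₀) (by omega) h0
  by_cases h1 : 0 ≤ f.coeff (e + d₁)
  · exact elevenNomial_le_eight_of_coeff_nonneg e d₀ d₁ d₂ d₃ cv hpos (e + d₁) (by omega) h1
  by_cases h2 : 0 ≤ f.coeff (e + d₂)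
  · exact elevenNomial_le_eight_of_coeff_nonneg e d₀ d₁ d₂ d₃ cv hpos (e + d₂) (by omega) h2
  by_cases h3 : 0 ≤ f.coeff (e + d₃)
  · exact elevenNomial_le_eight_of_coeff_nonneg e d₀ d₁ d₂ d₃ cv hpos (e + d₃) (by omega) h3
  push Not at hc h0 h1 h2 h3
  -- Step 2: all five negative; no degree at all strictly inside the empty gap
  have hzero : ∀ m, (∀ i : Fin 11, m ≠ (![2 * e, e + d₀, e + d₁, e + d₂, e + d₃, d₀ + d₁, d₀ + d₂, d₀ + d₃, d₁ + d₂, d₁ + d₃, d₂ + d₃] : Fin 11 → ℕ) i) →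
      f.coeff m ≤ 0 := by
    intro m hm
    rw [hf, coeff_elevenNomial]
    refine Finset.sum_nonpos fun i _ => ?_
    rw [if_neg (hm i)]
  have hneg : ∀ m, f.coeff m < 0 → m = 2 * e ∨ m = e + d₀ ∨ m = e + d₁ ∨ m = e + d₂ ∨ m = e + d₃ :=
    fun m hm => eq_pivotDegree_of_coeff_neg e d₀ d₁ d₂ d₃ cv hpos m hm
  refine (Census.card_posRoots_le_signVariations f).trans ?_
  rcases hgap with g | g | g | g
  · -- gap (e+d₀, e+d₁)
    have hw := signVariations_le_of_nonpos_window f (e + d₀) (e + d₁) (by omega) (fun m ha hb => by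
      rcases Nat.eq_or_lt_of_le ha with h | h
      · rw [← h]; exact h0.le
      rcases Nat.eq_or_lt_of_le hb with h' | h'
      · rw [h']; exact h1.le
      exact hzero m (fun i => by fin_cases i <;> simp <;> omega)) {2 * e, e + d₂, e + d₃}
      (fun m hm hout => by have := hneg m hm; simp only [Finset.mem_insert, Finset.mem_singleton]; omega)
    have : ({2 * e, e + d₂, e + d₃} : Finset ℕ).card ≤ 3 := Finset.card_le_three
    omega
  · -- gap (e+d₁, 2e)
    have hw := signVariations_le_of_nonpos_window f (e + d₁) (2 * e) (by omega) (fun m ha hb => by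
      rcases Nat.eq_or_lt_of_le ha with h | h
      · rw [← h]; exact h1.le
      rcases Nat.eq_or_lt_of_le hb with h' | h'
      · rw [h']; exact hc.le
      exact hzero m (fun i => by fin_cases i <;> simp <;> omega)) {e + d₀, e + d₂, e + d₃}
      (fun m hm hout => by have := hneg m hm; simp only [Finset.mem_insert, Finset.mem_singleton]; omega)
    have : ({e + d₀, e + d₂, e + d₃} : Finset ℕ).card ≤ 3 := Finset.card_le_three
    omega
  · -- gap (2e, e+d₂)
    have hw := signVariations_le_of_nonpos_window f (2 * e) (e + d₂) (by omega) (fun m ha hb => by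
      rcases Nat.eq_or_lt_of_le ha with h | h
      · rw [← h]; exact hc.le
      rcases Nat.eq_or_lt_of_le hb with h' | h'
      · rw [h']; exact h2.le
      exact hzero m (fun i => by fin_cases i <;> simp <;> omega)) {e + d₀, e + d₁, e + d₃}
      (fun m hm hout => by have := hneg m hm; simp only [Finset.mem_insert, Finset.mem_singleton]; omega)
    have : ({e + d₀, e + d₁, e + d₃} : Finset ℕ).card ≤ 3 := Finset.card_le_three
    omega
  · -- gap (e+d₂, e+d₃)
    have hw := signVariations_le_of_nonpos_window f (e + d₂) (e + d₃) (by omega) (fun m ha hb => by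
      rcases Nat.eq_or_lt_of_le ha with h | h
      · rw [← h]; exact h2.le
      rcases Nat.eq_or_lt_of_le hb with h' | h'
      · rw [h']; exact h3.le
      exact hzero m (fun i => by fin_cases i <;> simp <;> omega)) {2 * e, e + d₀, e + d₁}
      (fun m hm hout => by have := hneg m hm; simp only [Finset.mem_insert, Finset.mem_singleton]; omega)
    have : ({2 * e, e + d₀, e + d₁} : Finset ℕ).card ≤ 3 := Finset.card_le_three
    omega

/-- **Outside the two interleaving chambers one of the four gaps is empty.**  The Descartes count of the all-core eleven-nomial is the
maximal `10` exactly when the five pivot-type degrees are perfectly interleaved with the pair degrees, which happens in precisely two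
orders («chamber (B)» `p01 s0 p02 s1 p12 c p03 s2 p13 s3 p23` and its mirror «chamber (A)» `p01 s0 p02 s1 p03 c p12 s2 p13 s3 p23`);
in every other configuration some gap between consecutive pivot-type degrees is free of pair degrees. [this file; linear arithmetic] -/
theorem gap_of_not_interleaving (e d₀ d₁ d₂ d₃ : ℕ)
    (hB : ¬ (d₁ + d₂ < 2 * e ∧ d₀ + d₂ < e + d₁ ∧ 2 * e < d₀ + d₃ ∧ d₀ + d₃ < e + d₂))
    (hA : ¬ (e + d₁ < d₀ + d₃ ∧ d₀ + d₃ < 2 * e ∧ 2 * e < d₁ + d₂ ∧ e + d₂ < d₁ + d₃)) :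
    (e + d₁ ≤ d₀ + d₂)
      ∨ (2 * e ≤ d₁ + d₂ ∧ (d₀ + d₂ ≤ e + d₁ ∨ 2 * e ≤ d₀ + d₂) ∧ (d₀ + d₃ ≤ e + d₁ ∨ 2 * e ≤ d₀ + d₃))
      ∨ (d₁ + d₂ ≤ 2 * e ∧ (d₁ + d₃ ≤ 2 * e ∨ e + d₂ ≤ d₁ + d₃) ∧ (d₀ + d₃ ≤ 2 * e ∨ e + d₂ ≤ d₀ + d₃))
      ∨ (d₁ + d₃ ≤ e + d₂) := by
  omega

/-- **RANK-ONE `(2,4)₁` OUTSIDE THE INTERLEAVING CHAMBERS: `Z₊ ≤ 8 = 2K` (real-parameter form).**  The eleven-nomial of a `(2,4)₁`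
pencil with rank-one letters (pair coefficients `wₖwₗΔₖₗ² ≥ 0`; pivot determinant and the four pairings ARBITRARY real numbers — no
hard-cell hypothesis is needed) has at most eight positive roots unless the exponents lie in the open interleaving chamber (B)
(`d₁+d₂ < 2e`, `d₀+d₂ < e+d₁`, `2e < d₀+d₃ < e+d₂`) or its mirror (A). [this file] -/
theorem elevenNomial_le_eight_of_not_interleaving (e d₀ d₁ d₂ d₃ : ℕ) (h01 : d₀ < d₁) (h1e : d₁ < e) (he2 : e < d₂) (h23 : d₂ < d₃)
    (hB : ¬ (d₁ + d₂ < 2 * e ∧ d₀ + d₂ < e + d₁ ∧ 2 * e < d₀ + d₃ ∧ d₀ + d₃ < e + d₂))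
    (hA : ¬ (e + d₁ < d₀ + d₃ ∧ d₀ + d₃ < 2 * e ∧ 2 * e < d₁ + d₂ ∧ e + d₂ < d₁ + d₃))
    (dJ m₀ m₁ m₂ m₃ w₀ w₁ w₂ w₃ D01 D02 D03 D12 D13 D23 : ℝ) (hw₀ : 0 ≤ w₀) (hw₁ : 0 ≤ w₁) (hw₂ : 0 ≤ w₂) (hw₃ : 0 ≤ w₃)
    (hD01 : 0 ≤ D01) (hD02 : 0 ≤ D02) (hD03 : 0 ≤ D03) (hD12 : 0 ≤ D12) (hD13 : 0 ≤ D13) (hD23 : 0 ≤ D23) :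
    ((∑ i : Fin 11, Polynomial.C ((![dJ, w₀ * m₀, w₁ * m₁, w₂ * m₂, w₃ * m₃, w₀ * w₁ * D01, w₀ * w₂ * D02, w₀ * w₃ * D03, w₁ * w₂ * D12, w₁ * w₃ * D13, w₂ * w₃ * D23] : Fin 11 → ℝ) i) * X ^ ((![2 * e, e + d₀, e + d₁, e + d₂, e + d₃, d₀ + d₁, d₀ + d₂, d₀ + d₃, d₁ + d₂, d₁ + d₃, d₂ + d₃] : Fin 11 → ℕ) i)).roots.toFinset.filter (fun t => 0 < t)).card ≤ 8 :=
  elevenNomial_le_eight_of_gap e d₀ d₁ d₂ d₃ h01 h1e he2 h23 (gap_of_not_interleaving e d₀ d₁ d₂ d₃ hB hA) _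
    (fun i hi => by
      fin_cases i <;> simp at hi ⊢ <;> positivity)

/-- **RANK-ONE `(2,4)₁` OUTSIDE THE INTERLEAVING CHAMBERS: `Z₊ ≤ 8 = 2K` (matrix form).**  `F = X^e J + ∑ₖ wₖ X^{dₖ} vₖvₖᵀ` with
`J` ANY real `2 × 2` matrix, ANY directions `vₖ`, weights `wₖ ≥ 0`, two letters below and two above the pivot (`d₀ < d₁ < e < d₂ < d₃`):
if the exponents are not in the open interleaving chamber (B) nor in its mirror (A), `det F` has at most EIGHT distinct positive roots.
So the rank-one law «`(2,4)₁ ≤ 8`» is OPEN ONLY inside those two chambers (where Descartes allows `10`; the kill-seven files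
`…PivotRankOneFourKillSeven{,Prime,Pairs,Bottom}` bound chamber (B) by `8` under explicit conditions). [this file] -/
theorem rankOne_posRoots_le_eight_of_not_interleaving (e d₀ d₁ d₂ d₃ : ℕ) (h01 : d₀ < d₁) (h1e : d₁ < e) (he2 : e < d₂)
    (h23 : d₂ < d₃)
    (hB : ¬ (d₁ + d₂ < 2 * e ∧ d₀ + d₂ < e + d₁ ∧ 2 * e < d₀ + d₃ ∧ d₀ + d₃ < e + d₂))
    (hA : ¬ (e + d₁ < d₀ + d₃ ∧ d₀ + d₃ < 2 * e ∧ 2 * e < d₁ + d₂ ∧ e + d₂ < d₁ + d₃))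
    (J : Matrix (Fin 2) (Fin 2) ℝ) (v₀ v₁ v₂ v₃ : Fin 2 → ℝ) (w₀ w₁ w₂ w₃ : ℝ) (hw₀ : 0 ≤ w₀) (hw₁ : 0 ≤ w₁) (hw₂ : 0 ≤ w₂)
    (hw₃ : 0 ≤ w₃) :
    ((Matrix.det (((X : ℝ[X]) ^ e) • J.map Polynomial.C
        + (Polynomial.C w₀ * X ^ d₀) • (vecMulVec v₀ v₀).map Polynomial.C
        + (Polynomial.C w₁ * X ^ d₁) • (vecMulVec v₁ v₁).map Polynomial.C
        + (Polynomial.C w₂ * X ^ d₂) • (vecMulVec v₂ v₂).map Polynomial.C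
        + (Polynomial.C w₃ * X ^ d₃) • (vecMulVec v₃ v₃).map Polynomial.C)).roots.toFinset.filter (fun t => 0 < t)).card
      ≤ 8 := by
  rw [TwoDirections.BlockLaw.det_rankOne_four_sum]
  exact elevenNomial_le_eight_of_not_interleaving e d₀ d₁ d₂ d₃ h01 h1e he2 h23 hB hA J.det _ _ _ _ w₀ w₁ w₂ w₃ _ _ _ _ _ _
    hw₀ hw₁ hw₂ hw₃ (sq_nonneg _) (sq_nonneg _) (sq_nonneg _) (sq_nonneg _) (sq_nonneg _) (sq_nonneg _)

end Summit.ValiantsHypothesis.ValiantsHypothesis.Theorems.LacunarySymmetroidMatrixDescartes.Pivot.RankOneReduction
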